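import Mathlib
import HarnessLib
import Literature.Dynamics.Hamiltonian.ArnoldDiffusionCAP.InstanceA

/-!
# CAP Instance A — the reflection symmetry `S(φ, I, q, p) = (−φ, −I, q, p)` and time-periodicity of the vector field; DESCENT ⇒ `Claim`

CITATION HEADER (lean-in-tree rule, cell pub-adcap, 2026-08-19, seat 1 gen 5). Elementary, fully PROVED facts about the literal vector field
`…InstanceA.vectorField` of [cite: DelshamsDelallaveSeara2006, Ch. 13 (13.1)] with `g(φ, t) = cos φ + cos t`:
(1) `vectorField_reflect`: `X(ε, t, S x) = S · X(ε, t, x)` for the linear involution `S(φ, I, q, p) = (−φ, −I, q, p)` (because `cos φ` is even and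
`sin φ` odd), hence `IsSolution.reflect`: `S ∘ γ` is a solution whenever `γ` is; (2) `vectorField_add_int_mul_two_pi`: the field is `2π`-periodic
in `t` (only `cos t` enters), hence `IsSolution.timeShift`: `s ↦ γ(s + 2πk)` is a solution; (3) `Claim.of_descent`: consequently a certificate
whose computed orbit DESCENDS in action (from a window `W₀` in the section `t = 2πm₀` down by `deltaI` within `timeBound`) establishes
`Claim c` for the record `c` whose box contains `S(W₀)` — the witness is the reflected, time-shifted orbit. This is the reduction used by the
descending-branch certificates of seat 1 (HOME/certs/instanceA/thread3S-…): their two rigorous implementations verify the descending chain of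
covering relations; the passage to the `Claim` shape is THIS file, kernel-checked, instead of a paragraph in a README. Nothing here is numerical
and nothing asserts any `Claim`. (4) `translate`, `vectorField_translate`, `IsSolution.translate`, `Claim.of_descent_translate`: the field is
`2π`-periodic in `φ` and `q` as well, so the box may record the angles of `S(W₀)` reduced modulo `2π`.
-/

noncomputable section
open Set
namespace Literature.Dynamics.Hamiltonian.ArnoldDiffusionCAP.InstanceA

/-- The reflection `S(φ, I, q, p) = (−φ, −I, q, p)`. [folklore] -/
def reflect (x : Pt) : Pt := ![-(x 0), -(x 1), x 2, x 3]

/-- `S` negates the rotator angle `φ` (slot 0). [folklore] -/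
@[simp] theorem reflect_apply_zero (x : Pt) : reflect x 0 = -(x 0) := rfl
/-- `S` negates the action `I` (slot 1). [folklore] -/
@[simp] theorem reflect_apply_one (x : Pt) : reflect x 1 = -(x 1) := rfl
/-- `S` keeps the pendulum angle `q` (slot 2). [folklore] -/
@[simp] theorem reflect_apply_two (x : Pt) : reflect x 2 = x 2 := rfl
/-- `S` keeps the pendulum momentum `p` (slot 3). [folklore] -/
@[simp] theorem reflect_apply_three (x : Pt) : reflect x 3 = x 3 := rfl

/-- `S` is a symmetry of the Instance-A vector field at every `(ε, t)`: `X(ε, t, S x) = dS · X(ε, t, x)`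
(`cos φ` is even, `sin φ` odd). [folklore] -/
theorem vectorField_reflect (ε t : ℝ) (x : Pt) :
    vectorField ε t (reflect x) = reflect (vectorField ε t x) := by
  ext i
  fin_cases i <;> simp [vectorField, reflect, Real.sin_neg, Real.cos_neg]

/-- The vector field is `2π`-periodic in time (only `cos t` enters). [folklore] -/
theorem vectorField_add_int_mul_two_pi (ε t : ℝ) (k : ℤ) (x : Pt) :
    vectorField ε (t + k * (2 * Real.pi)) x = vectorField ε t x := by
  ext i
  fin_cases i <;> simp [vectorField, Real.cos_add_int_mul_two_pi]

/-- Lemma S, solutions: if `γ` solves the system at `ε` then so does `S ∘ γ`. [folklore] -/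
theorem IsSolution.reflect {ε : ℝ} {γ : ℝ → Pt} (h : IsSolution ε γ) :
    IsSolution ε (fun t => reflect (γ t)) := by
  intro t
  have hc : ∀ i, HasDerivAt (fun s => γ s i) (vectorField ε t (γ t) i) t := fun i => (hasDerivAt_pi.1 (h t)) i
  rw [vectorField_reflect]
  apply hasDerivAt_pi.2
  intro i
  fin_cases i
  · simpa [Pi.neg_def] using (hc 0).neg
  · simpa [Pi.neg_def] using (hc 1).neg
  · simpa using hc 2
  · simpa using hc 3

/-- Time shift by a period: if `γ` solves the system then so does `s ↦ γ (s + 2πk)`, `k ∈ ℤ`. [folklore] -/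
theorem IsSolution.timeShift {ε : ℝ} {γ : ℝ → Pt} (h : IsSolution ε γ) (k : ℤ) :
    IsSolution ε (fun s => γ (s + k * (2 * Real.pi))) := by
  intro s
  have h1 : HasDerivAt (fun s => γ (s + k * (2 * Real.pi))) (vectorField ε (s + k * (2 * Real.pi)) (γ (s + k * (2 * Real.pi)))) s := by
    have := (h (s + k * (2 * Real.pi))).comp_add_const s (k * (2 * Real.pi))
    simpa using this
  rw [vectorField_add_int_mul_two_pi] at h1
  exact h1

/-- The reflected box: if `c.box` contains the `S`-image of the box `[lo, hi]` coordinate-wise (`φ`, `I` bounds negated and swapped,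
`q`, `p` bounds kept — with room for outward rounding), then `S x ∈ c.box` for every `x ∈ [lo, hi]`. [folklore] -/
theorem reflect_mem_box (c : Certificate) (lo hi x : Pt)
    (hx : ∀ i, lo i ≤ x i ∧ x i ≤ hi i)
    (h0 : c.boxLo 0 ≤ -(hi 0)) (h0' : -(lo 0) ≤ c.boxHi 0) (h1 : c.boxLo 1 ≤ -(hi 1)) (h1' : -(lo 1) ≤ c.boxHi 1)
    (h2 : c.boxLo 2 ≤ lo 2) (h2' : hi 2 ≤ c.boxHi 2) (h3 : c.boxLo 3 ≤ lo 3) (h3' : hi 3 ≤ c.boxHi 3) :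
    reflect x ∈ c.box := by
  intro i
  fin_cases i
  · simp; constructor <;> linarith [(hx 0).1, (hx 0).2]
  · simp; constructor <;> linarith [(hx 1).1, (hx 1).2]
  · simp; constructor <;> linarith [(hx 2).1, (hx 2).2]
  · simp; constructor <;> linarith [(hx 3).1, (hx 3).2]

/-- DESCENT ⇒ CLAIM (the reduction used by descending-branch certificates). Suppose that for every `ε` in the interval
there is a solution `γ` which at the time `t₀ = 2πm₀` lies in a set `W₀` whose `S`-image is inside `c.box`, and whose
action has DROPPED by at least `c.deltaI` at a later time `t₀ + T`, `T ∈ [0, timeBound]`. Then `Claim c` holds: the witness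
is the reflected, time-shifted solution `s ↦ S(γ(s + 2πm₀))`. [folklore] -/
theorem Claim.of_descent (c : Certificate) (h0 : 0 < c.epsLo) (h01 : c.epsLo ≤ c.epsHi) (hd : 0 < c.deltaI) (m₀ : ℤ)
    (H : ∀ ε ∈ Icc c.epsLo c.epsHi, ∃ γ : ℝ → Pt, IsSolution ε γ ∧ reflect (γ (m₀ * (2 * Real.pi))) ∈ c.box ∧
      ∃ T ∈ Icc (0 : ℝ) c.timeBound, c.deltaI ≤ γ (m₀ * (2 * Real.pi)) 1 - γ (m₀ * (2 * Real.pi) + T) 1) :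
    Claim c := by
  refine ⟨h0, h01, hd, fun ε hε => ?_⟩
  obtain ⟨γ, hsol, hbox, T, hT, hdrop⟩ := H ε hε
  refine ⟨fun s => reflect (γ (s + m₀ * (2 * Real.pi))), (hsol.timeShift m₀).reflect, by simpa using hbox, T, hT, ?_⟩
  simp only [reflect_apply_one, zero_add]
  rw [add_comm T]
  linarith

/-- The lattice translation `(φ, I, q, p) ↦ (φ + 2πa, I, q + 2πb, p)`, `a, b ∈ ℤ` (the angles live on the universal cover). [folklore] -/
def translate (a b : ℤ) (x : Pt) : Pt := ![x 0 + a * (2 * Real.pi), x 1, x 2 + b * (2 * Real.pi), x 3]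

/-- `translate` shifts `φ` (slot 0) by `2πa`. [folklore] -/
@[simp] theorem translate_apply_zero (a b : ℤ) (x : Pt) : translate a b x 0 = x 0 + a * (2 * Real.pi) := rfl
/-- `translate` keeps `I` (slot 1). [folklore] -/
@[simp] theorem translate_apply_one (a b : ℤ) (x : Pt) : translate a b x 1 = x 1 := rfl
/-- `translate` shifts `q` (slot 2) by `2πb`. [folklore] -/
@[simp] theorem translate_apply_two (a b : ℤ) (x : Pt) : translate a b x 2 = x 2 + b * (2 * Real.pi) := rfl
/-- `translate` keeps `p` (slot 3). [folklore] -/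
@[simp] theorem translate_apply_three (a b : ℤ) (x : Pt) : translate a b x 3 = x 3 := rfl

/-- The vector field is `2π`-periodic in `φ` and `q`: it takes the same value at `x` and at any lattice translate of `x`. [folklore] -/
theorem vectorField_translate (ε t : ℝ) (a b : ℤ) (x : Pt) :
    vectorField ε t (translate a b x) = vectorField ε t x := by
  ext i
  fin_cases i <;> simp [vectorField, translate, Real.sin_add_int_mul_two_pi, Real.cos_add_int_mul_two_pi]

/-- Lattice translation of solutions: if `γ` solves the system then so does `translate a b ∘ γ`. [folklore] -/
theorem IsSolution.translate {ε : ℝ} {γ : ℝ → Pt} (h : IsSolution ε γ) (a b : ℤ) :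
    IsSolution ε (fun t => translate a b (γ t)) := by
  intro t
  have hc : ∀ i, HasDerivAt (fun s => γ s i) (vectorField ε t (γ t) i) t := fun i => (hasDerivAt_pi.1 (h t)) i
  rw [vectorField_translate]
  apply hasDerivAt_pi.2
  intro i
  fin_cases i
  · simpa using (hc 0).add_const ((a : ℝ) * (2 * Real.pi))
  · simpa using hc 1
  · simpa using (hc 2).add_const ((b : ℝ) * (2 * Real.pi))
  · simpa using hc 3

/-- DESCENT ⇒ CLAIM with the angles reduced: as `Claim.of_descent`, but the box is required to contain a LATTICE TRANSLATE
`translate a b (S(γ(2πm₀)))` of the reflected point (so a certificate may record `φ` and `q` reduced modulo `2π`). The witness is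
`s ↦ translate a b (S(γ(s + 2πm₀)))`. [folklore] -/
theorem Claim.of_descent_translate (c : Certificate) (h0 : 0 < c.epsLo) (h01 : c.epsLo ≤ c.epsHi) (hd : 0 < c.deltaI)
    (m₀ a b : ℤ)
    (H : ∀ ε ∈ Icc c.epsLo c.epsHi, ∃ γ : ℝ → Pt, IsSolution ε γ ∧ translate a b (reflect (γ (m₀ * (2 * Real.pi)))) ∈ c.box ∧
      ∃ T ∈ Icc (0 : ℝ) c.timeBound, c.deltaI ≤ γ (m₀ * (2 * Real.pi)) 1 - γ (m₀ * (2 * Real.pi) + T) 1) :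
    Claim c := by
  refine ⟨h0, h01, hd, fun ε hε => ?_⟩
  obtain ⟨γ, hsol, hbox, T, hT, hdrop⟩ := H ε hε
  refine ⟨fun s => translate a b (reflect (γ (s + m₀ * (2 * Real.pi)))), ((hsol.timeShift m₀).reflect).translate a b, by simpa using hbox, T, hT, ?_⟩
  simp only [translate_apply_one, reflect_apply_one, zero_add]
  rw [add_comm T]
  linarith

end Literature.Dynamics.Hamiltonian.ArnoldDiffusionCAP.InstanceA
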